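import Mathlib
import Literature.NumberTheory.Transcendental.KZLogCalculusProofs
import Literature.NumberTheory.Transcendental.SemialgebraicDerivative
import Literature.NumberTheory.Transcendental.SemialgebraicDerivativeProofs
import Summits.KontsevichZagierPeriods.KontsevichZagierPeriods.Theses.LiouvilleUnfolding
import Summits.KontsevichZagierPeriods.KontsevichZagierPeriods.Theorems.LiouvilleUnfoldingUnfoldedLogStokesStubFoldIntegrable
import Summits.KontsevichZagierPeriods.KontsevichZagierPeriods.Theorems.LiouvilleUnfoldingUnfoldedLogStokesStubVelocityExtension
import Summits.KontsevichZagierPeriods.KontsevichZagierPeriods.Theorems.LiouvilleUnfoldingUnfoldedLogStokesStubNullNormalise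

/-!
# `UnfoldedLogStokes` (stmt-KontsevichZagierPeriods-2835) — line `engine-transport`

Crux of route `LiouvilleUnfolding` (rank 2): the pure-KZ engine of unfolding,
`of r₁ − of r₂ + of r₃ + of r₄ ∈ KZ.relations` for the four honest representations unfolding
`d/dt (H log V) = H' log V + H V'/V` over a semialgebraic band.

Line `engine-transport`: the crux is ONE instance of the tree engine
`Literature.NumberTheory.Transcendental.KZ.unfoldedLogStokes_mem_relations` (fibrewise substitution
`u = 1 + s (V − 1)`, two Newton–Leibniz moves and a coordinate swap — no cylindrical decomposition),
with `W := r₁`, `RB := r₄`, `Ub := r₂`, `Ua := r₃.neg`, after three glue steps, the line's stubs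
(each landed in its own file `Theorems/LiouvilleUnfoldingUnfoldedLogStokesStub*.lean`, imported here):

* `stub_velocityExtension` — a fibre derivative given on OPEN fibres only has a `ℚ`-semialgebraic
  surrogate on the CLOSED band (Basu–Pollack–Roy Prop. 3.22, in tree as
  `IsSemialgebraicFunOn.hasDerivAt_last_isSemialgebraic_holds`, glued with `0` on the edge graphs);
* `stub_nullNormalise` — two representations on one domain whose integrands agree off a null
  semialgebraic set differ by a relation (rule 1a twice);
* `stub_foldIntegrable` — Tonelli read-off: `(x,u) ↦ h x / u` integrable on `{1 ≤ u ≤ v x}` gives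
  `h · log v ∈ L¹` (the integrability hypotheses of the tree engine are READ OFF `r₁, r₂, r₃`).

Composition: `engineOfReps` (representation form of the engine:
velocity surrogate for `V`, null-normalised twins of `RB`, `W`, defolded integrability, boundary
compositions, then the tree engine verbatim) and the dictionary `UnfoldedLogStokes_of`
(`H'' := r₁.integrand (·, 1)`, `P := r₄.integrand · V`, sign of `r₃` via `of r + of r.neg`).
Sources: Kontsevich–Zagier 2001 §1.1–1.2 (unfolding device); Basu–Pollack–Roy 2006 Prop. 3.22.
-/

noncomputable section

open MeasureTheory Set
open Literature.NumberTheory.Transcendental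
open Literature.ModelTheory.ExponentialFields (IsSemialgebraic)

namespace Summit.KontsevichZagierPeriods.LiouvilleUnfolding.Engine

/-! ## Composition: the representation-form engine from the tree engine -/

/-- **The engine in representation form.** The tree engine `KZ.unfoldedLogStokes_mem_relations`
re-run with a single function `P` in place of `H · V'` (only `P / V = RB.integrand` on the band and
`P = H · V'` on open fibres are asked — no semialgebraicity of `V'`), with the unfolded monomial `W`
pinned only over the OPEN band, and with every integrability hypothesis defolded from the four
representations: velocity surrogate for `V`
(`stub_velocityExtension`), null-normalised twins of `RB` and `W` along the edge graphs of `a`, `b`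
(`stub_nullNormalise`), integrability read off `W`, `Ub`, `Ua` (`stub_foldIntegrable`), boundary
compositions by Tarski–Seidenberg, then the tree engine verbatim.
[cite: KontsevichZagier2001, §1.1–1.2] -/
theorem engineOfReps (n : ℕ) (τ : Set (Fin n → ℝ)) (a b : (Fin n → ℝ) → ℝ)
    (H H' V V' P : (Fin (n + 1) → ℝ) → ℝ)
    (RB : KZ.IntegralRep (n + 1)) (W : KZ.IntegralRep (n + 2)) (Ub Ua : KZ.IntegralRep (n + 1))
    (hτ : IsSemialgebraic ℚ τ) (ha : IsSemialgebraicFunOn ℚ τ a) (hb : IsSemialgebraicFunOn ℚ τ b)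
    (hab : ∀ x ∈ τ, a x ≤ b x)
    (hH : IsSemialgebraicFunOn ℚ (KZlog.band τ a b) H)
    (hH' : IsSemialgebraicFunOn ℚ (KZlog.band τ a b) H')
    (hV : IsSemialgebraicFunOn ℚ (KZlog.band τ a b) V)
    (hV1 : ∀ z ∈ KZlog.band τ a b, 1 ≤ V z)
    (hcont : ∀ x ∈ τ, ContinuousOn (fun t : ℝ => H (Fin.snoc x t)) (Icc (a x) (b x)) ∧
      ContinuousOn (fun t : ℝ => V (Fin.snoc x t)) (Icc (a x) (b x)))
    (hder : ∀ x ∈ τ, ∀ t ∈ Ioo (a x) (b x),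
      HasDerivAt (fun s : ℝ => H (Fin.snoc x s)) (H' (Fin.snoc x t)) t ∧
      HasDerivAt (fun s : ℝ => V (Fin.snoc x s)) (V' (Fin.snoc x t)) t)
    (hPeq : ∀ x ∈ τ, ∀ t ∈ Ioo (a x) (b x),
      P (Fin.snoc x t) = H (Fin.snoc x t) * V' (Fin.snoc x t))
    (hRBd : RB.domain = KZlog.band τ a b)
    (hRBi : EqOn RB.integrand (fun z => P z / V z) RB.domain)
    (hWd : W.domain = KZlog.band (KZlog.band τ a b) (fun _ => 1) V)
    (hWi : ∀ w ∈ W.domain, a (Fin.init (Fin.init w)) < Fin.init w (Fin.last n) →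
      Fin.init w (Fin.last n) < b (Fin.init (Fin.init w)) →
      W.integrand w = H' (Fin.init w) / w (Fin.last (n + 1)))
    (hUbd : Ub.domain = KZlog.band τ (fun _ => 1) (fun x => V (Fin.snoc x (b x))))
    (hUbi : EqOn Ub.integrand (fun z => H (Fin.snoc (Fin.init z) (b (Fin.init z))) / z (Fin.last n))
      Ub.domain)
    (hUad : Ua.domain = KZlog.band τ (fun _ => 1) (fun x => V (Fin.snoc x (a x))))
    (hUai : EqOn Ua.integrand (fun z => -H (Fin.snoc (Fin.init z) (a (Fin.init z))) / z (Fin.last n))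
      Ua.domain) :
    KZ.of RB + KZ.of W - KZ.of Ub - KZ.of Ua ∈ KZ.relations := by
  have hBsa : IsSemialgebraic ℚ (KZlog.band τ a b) := KZlog.isSemialgebraic_band ha hb
  have hBm : MeasurableSet (KZlog.band τ a b) := IsSemialgebraic.measurableSet_holds hBsa
  have hτm : MeasurableSet τ := IsSemialgebraic.measurableSet_holds hτ
  have hV0 : ∀ z ∈ KZlog.band τ a b, V z ≠ 0 := fun z hz => (one_pos.trans_le (hV1 z hz)).ne'
  have hmemB : ∀ x ∈ τ, ∀ t ∈ Icc (a x) (b x), (Fin.snoc x t : Fin (n + 1) → ℝ) ∈ KZlog.band τ a b :=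
    fun x hx t ht => KZlog.snoc_mem_band.2 ⟨hx, ht⟩
  -- (1) the definable velocity of `V`, extended to the closed band
  obtain ⟨V'', hV''sa, hderV''⟩ :=
    stub_velocityExtension n τ a b V V' hτ ha hb hV fun x hx t ht => (hder x hx t ht).2
  have hder'' : ∀ x ∈ τ, ∀ t ∈ Ioo (a x) (b x),
      HasDerivAt (fun s : ℝ => H (Fin.snoc x s)) (H' (Fin.snoc x t)) t ∧
      HasDerivAt (fun s : ℝ => V (Fin.snoc x s)) (V'' (Fin.snoc x t)) t :=
    fun x hx t ht => ⟨(hder x hx t ht).1, hderV'' x hx t ht⟩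
  have hV''eq : ∀ x ∈ τ, ∀ t ∈ Ioo (a x) (b x), V'' (Fin.snoc x t) = V' (Fin.snoc x t) :=
    fun x hx t ht => (hderV'' x hx t ht).unique (hder x hx t ht).2
  -- (2) the null boundary: graphs of `a` and `b` over `τ`
  set Nb : Set (Fin (n + 1) → ℝ) := {z | Fin.init z ∈ τ ∧ z (Fin.last n) = a (Fin.init z)} ∪
    {z | Fin.init z ∈ τ ∧ z (Fin.last n) = b (Fin.init z)} with hNb
  have hNb_sa : IsSemialgebraic ℚ Nb :=
    (isSemialgebraicFunOn_iff.mp ha).union (isSemialgebraicFunOn_iff.mp hb)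
  have hNb0 : volume Nb = 0 :=
    measure_union_null (KZ.volume_graph_eq_zero ha) (KZ.volume_graph_eq_zero hb)
  have hinterior : ∀ z ∈ KZlog.band τ a b, z ∉ Nb →
      a (Fin.init z) < z (Fin.last n) ∧ z (Fin.last n) < b (Fin.init z) := by
    intro z hz hzN
    simp only [hNb, mem_union, mem_setOf_eq, not_or, not_and] at hzN
    exact ⟨lt_of_le_of_ne hz.2.1 (fun h => hzN.1 hz.1 h.symm),
      lt_of_le_of_ne hz.2.2 (fun h => hzN.2 hz.1 h)⟩
  -- (3) `RB' = [band, H V''/V]`, a null modification of `RB`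
  have hRB'sa : IsSemialgebraicFunOn ℚ (KZlog.band τ a b) (fun z => H z * V'' z / V z) :=
    IsSemialgebraicFunOn.div (IsSemialgebraicFunOn.mul_holds hH hV''sa) hV hV0
  have hRB'eq : ∀ z ∈ KZlog.band τ a b, z ∉ Nb → RB.integrand z = H z * V'' z / V z := by
    intro z hz hzN
    obtain ⟨h1, h2⟩ := hinterior z hz hzN
    have hx : Fin.init z ∈ τ := hz.1
    have k1 := hPeq (Fin.init z) hx (z (Fin.last n)) ⟨h1, h2⟩
    have k2 := hV''eq (Fin.init z) hx (z (Fin.last n)) ⟨h1, h2⟩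
    simp only [Fin.snoc_init_self] at k1 k2
    rw [hRBi (show z ∈ RB.domain by rw [hRBd]; exact hz)]
    show P z / V z = H z * V'' z / V z
    rw [k1, k2]
  have hRB'int : IntegrableOn (fun z => H z * V'' z / V z) (KZlog.band τ a b) := by
    have h0 : IntegrableOn RB.integrand (KZlog.band τ a b) := hRBd ▸ RB.integrableOn
    refine h0.congr_fun_ae ?_
    filter_upwards [ae_restrict_of_ae (compl_mem_ae_iff.2 hNb0), ae_restrict_mem hBm] with z hzN hz
    exact hRB'eq z hz hzN
  let RB' : KZ.IntegralRep (n + 1) := ⟨KZlog.band τ a b, fun z => H z * V'' z / V z, hBsa, hRB'sa,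
    hRB'int⟩
  have hRBrel : KZ.of RB - KZ.of RB' ∈ KZ.relations :=
    stub_nullNormalise (n + 1) RB RB' Nb hRBd.symm hNb_sa hNb0
      fun z hz => hRB'eq z (by rw [← hRBd]; exact hz.1) hz.2
  -- (4) `W' = [W.domain, H'(init w)/u]`, a null modification of `W`
  have hWsa : IsSemialgebraic ℚ W.domain := W.isSemialgebraic_domain
  have hWm : MeasurableSet W.domain := IsSemialgebraic.measurableSet_holds hWsa
  have hW'sa : IsSemialgebraicFunOn ℚ W.domain (fun w => H' (Fin.init w) / w (Fin.last (n + 1))) := by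
    have hWB : W.domain ⊆ {w | Fin.init w ∈ KZlog.band τ a b} := by
      rw [hWd]; exact KZ.band_subset_setOf_init_mem
    have h1 : IsSemialgebraicFunOn ℚ W.domain (fun w => H' (Fin.init w)) := hH'.comp_init_mono hWsa hWB
    have h2 : IsSemialgebraicFunOn ℚ W.domain (fun w => 1 / w (Fin.last (n + 1))) :=
      (isSemialgebraicFunOn_aeval_div_aeval hWsa 1 (MvPolynomial.X (Fin.last (n + 1))) fun w hw => by
        rw [hWd] at hw
        simpa using (one_pos.trans_le hw.2.1).ne').congr fun w _ => by simp
    exact (IsSemialgebraicFunOn.mul_holds h1 h2).congr fun w _ => by simp [div_eq_mul_inv]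
  set Nw : Set (Fin (n + 2) → ℝ) := {w | Fin.init w ∈ Nb} with hNw
  have hNw_sa : IsSemialgebraic ℚ Nw := hNb_sa.setOf_init_mem
  have hNw0 : volume Nw = 0 := KZ.volume_setOf_init_mem_eq_zero hNb0
  have hW'eq : ∀ w ∈ W.domain, w ∉ Nw → W.integrand w = H' (Fin.init w) / w (Fin.last (n + 1)) := by
    intro w hw hwN
    have hw' : Fin.init w ∈ KZlog.band τ a b := by rw [hWd] at hw; exact hw.1
    obtain ⟨h1, h2⟩ := hinterior _ hw' hwN
    exact hWi w hw h1 h2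
  have hW'int : IntegrableOn (fun w => H' (Fin.init w) / w (Fin.last (n + 1))) W.domain := by
    refine W.integrableOn.congr_fun_ae ?_
    filter_upwards [ae_restrict_of_ae (compl_mem_ae_iff.2 hNw0), ae_restrict_mem hWm] with w hwN hw
    exact hW'eq w hw hwN
  let W' : KZ.IntegralRep (n + 2) := ⟨W.domain, fun w => H' (Fin.init w) / w (Fin.last (n + 1)), hWsa,
    hW'sa, hW'int⟩
  have hWrel : KZ.of W - KZ.of W' ∈ KZ.relations :=
    stub_nullNormalise (n + 2) W W' Nw rfl hNw_sa hNw0 fun w hw => hW'eq w hw.1 hw.2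
  -- (5) integrability, folded from `W`, `Ub`, `Ua`
  have hintH' : IntegrableOn (fun z => H' z * Real.log (V z)) (KZlog.band τ a b) :=
    stub_foldIntegrable (n + 1) (KZlog.band τ a b) Nb H' V W.integrand hBsa hH' hV hV1 hNb0
      (hWd ▸ W.integrableOn) fun w hw hwN => hW'eq w (by rw [hWd]; exact hw) hwN
  have hsnocMap : ∀ {c : (Fin n → ℝ) → ℝ}, IsSemialgebraicFunOn ℚ τ c →
      IsSemialgebraicMapOn ℚ τ (fun x => (Fin.snoc x (c x) : Fin (n + 1) → ℝ)) := by
    intro c hc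
    refine IsSemialgebraicMapOn.of_forall hτ fun j => ?_
    refine Fin.lastCases ?_ (fun i => ?_) j
    · simpa only [Fin.snoc_last] using hc
    · simpa only [Fin.snoc_castSucc] using isSemialgebraicFunOn_apply hτ i
  have hmapb : MapsTo (fun x => (Fin.snoc x (b x) : Fin (n + 1) → ℝ)) τ (KZlog.band τ a b) :=
    fun x hx => hmemB x hx _ ⟨hab x hx, le_rfl⟩
  have hmapa : MapsTo (fun x => (Fin.snoc x (a x) : Fin (n + 1) → ℝ)) τ (KZlog.band τ a b) :=
    fun x hx => hmemB x hx _ ⟨le_rfl, hab x hx⟩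
  have hHb : IsSemialgebraicFunOn ℚ τ fun x => H (Fin.snoc x (b x)) :=
    IsSemialgebraicFunOn.comp_isSemialgebraicMapOn_holds hH (hsnocMap hb) hmapb
  have hVb : IsSemialgebraicFunOn ℚ τ fun x => V (Fin.snoc x (b x)) :=
    IsSemialgebraicFunOn.comp_isSemialgebraicMapOn_holds hV (hsnocMap hb) hmapb
  have hHa : IsSemialgebraicFunOn ℚ τ fun x => H (Fin.snoc x (a x)) :=
    IsSemialgebraicFunOn.comp_isSemialgebraicMapOn_holds hH (hsnocMap ha) hmapa
  have hVa : IsSemialgebraicFunOn ℚ τ fun x => V (Fin.snoc x (a x)) :=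
    IsSemialgebraicFunOn.comp_isSemialgebraicMapOn_holds hV (hsnocMap ha) hmapa
  have hVb1 : ∀ x ∈ τ, 1 ≤ V (Fin.snoc x (b x)) := fun x hx => hV1 _ (hmapb hx)
  have hVa1 : ∀ x ∈ τ, 1 ≤ V (Fin.snoc x (a x)) := fun x hx => hV1 _ (hmapa hx)
  have hintb : IntegrableOn (fun x => H (Fin.snoc x (b x)) * Real.log (V (Fin.snoc x (b x)))) τ :=
    stub_foldIntegrable n τ ∅ (fun x => H (Fin.snoc x (b x))) (fun x => V (Fin.snoc x (b x)))
      Ub.integrand hτ hHb hVb hVb1 measure_empty (hUbd ▸ Ub.integrableOn)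
      fun z hz _ => hUbi (by rw [hUbd]; exact hz)
  have hinta' : IntegrableOn (fun x => -H (Fin.snoc x (a x)) * Real.log (V (Fin.snoc x (a x)))) τ :=
    stub_foldIntegrable n τ ∅ (fun x => -H (Fin.snoc x (a x))) (fun x => V (Fin.snoc x (a x)))
      Ua.integrand hτ hHa.neg hVa hVa1 measure_empty (hUad ▸ Ua.integrableOn)
      fun z hz _ => hUai (by rw [hUad]; exact hz)
  have hinta : IntegrableOn (fun x => H (Fin.snoc x (a x)) * Real.log (V (Fin.snoc x (a x)))) τ :=
    hinta'.neg.congr_fun (fun x _ => by simp [neg_mul]) hτm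
  -- (6) the tree engine, verbatim
  have key := KZ.unfoldedLogStokes_mem_relations hτ ha hb hab hH hH' hV hV''sa hV1 hcont hder''
    hRB'int hintH' hHb hVb hHa hVa hintb hinta RB' W' Ub Ua rfl (fun _ _ => rfl) hWd (fun _ _ => rfl)
    hUbd hUbi hUad hUai
  have hsum : KZ.of RB + KZ.of W - KZ.of Ub - KZ.of Ua =
      (KZ.of RB' + KZ.of W' - KZ.of Ub - KZ.of Ua) + (KZ.of RB - KZ.of RB') + (KZ.of W - KZ.of W') := by
    abel
  rw [hsum]
  exact KZ.relations.add_mem (KZ.relations.add_mem key hRBrel) hWrel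

/-! ## The dictionary onto the crux -/

/-- The `u = 1` slice of the band lies in the unfolded domain of `r₁` because `V ≥ 1`; this is what
lets the dictionary READ `H'` off `r₁` (`H'' z := r₁.integrand (Fin.snoc z 1)`). [folklore] -/
theorem snoc_one_mem_unfold {n : ℕ} {B : Set (Fin (n + 1) → ℝ)} {V : (Fin (n + 1) → ℝ) → ℝ}
    (hV1 : ∀ z ∈ B, 1 ≤ V z) {z : Fin (n + 1) → ℝ} (hz : z ∈ B) :
    (Fin.snoc z 1 : Fin (n + 2) → ℝ) ∈
      {w : Fin (n + 2) → ℝ | Fin.init w ∈ B ∧ 1 ≤ w (Fin.last (n + 1)) ∧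
        w (Fin.last (n + 1)) ≤ V (Fin.init w)} := by
  simp only [mem_setOf_eq, Fin.init_snoc, Fin.snoc_last, le_refl, true_and]
  exact ⟨hz, hV1 z hz⟩

/-- **The crux `UnfoldedLogStokes` of route `LiouvilleUnfolding`** (stmt-KontsevichZagierPeriods-2835),
by the dictionary `RB := r₄`, `W := r₁`, `Ub := r₂`, `Ua := r₃.neg`, `H'' := r₁.integrand (·, 1)`,
`P := r₄.integrand · V` onto `engineOfReps`, and the sign identity `of r₃ + of r₃.neg ∈ relations`.
[cite: KontsevichZagier2001, §1.1–1.2] -/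
theorem UnfoldedLogStokes_of :
    Summit.KontsevichZagierPeriods.KontsevichZagierPeriods.Theses.LiouvilleUnfolding.UnfoldedLogStokes := by
  intro n τ a b H H' V V' r₁ r₂ r₃ r₄ hτ ha hb hab hr₄d hH hV hV1 hcont hder hr₄i hr₁d hr₁i hr₂d hr₂i
    hr₃d hr₃i
  -- the band
  have hBeq : r₄.domain = KZlog.band τ a b := by rw [hr₄d]; rfl
  have hmemB : ∀ x ∈ τ, ∀ t ∈ Icc (a x) (b x), (Fin.snoc x t : Fin (n + 1) → ℝ) ∈ r₄.domain := by
    intro x hx t ht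
    rw [hBeq]
    exact KZlog.snoc_mem_band.2 ⟨hx, ht⟩
  have hV0 : ∀ z ∈ r₄.domain, V z ≠ 0 := fun z hz => (one_pos.trans_le (hV1 z hz)).ne'
  -- the `u = 1` slice of the band lies in `r₁.domain`
  have hslice : ∀ z ∈ r₄.domain, (Fin.snoc z 1 : Fin (n + 2) → ℝ) ∈ r₁.domain := by
    intro z hz
    rw [hr₁d]
    exact snoc_one_mem_unfold hV1 hz
  -- `H''` read off `r₁`
  set H'' : (Fin (n + 1) → ℝ) → ℝ := fun z => r₁.integrand (Fin.snoc z 1) with hH''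
  have hH''eq : ∀ z ∈ r₄.domain, a (Fin.init z) < z (Fin.last n) → z (Fin.last n) < b (Fin.init z) →
      H'' z = H' z := by
    intro z hz h1 h2
    have hw := hslice z hz
    have := hr₁i _ hw (by simpa using h1) (by simpa using h2)
    simpa [hH''] using this
  have hι : IsSemialgebraicMapOn ℚ r₄.domain (fun z => (Fin.snoc z (1 : ℝ) : Fin (n + 2) → ℝ)) := by
    refine IsSemialgebraicMapOn.of_forall r₄.isSemialgebraic_domain fun j => ?_
    refine Fin.lastCases ?_ (fun i => ?_) j
    · simpa only [Fin.snoc_last] using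
        (isSemialgebraicFunOn_ratCast r₄.isSemialgebraic_domain 1).congr fun _ _ => by simp
    · simpa only [Fin.snoc_castSucc] using isSemialgebraicFunOn_apply r₄.isSemialgebraic_domain i
  have hH''sa : IsSemialgebraicFunOn ℚ r₄.domain H'' :=
    IsSemialgebraicFunOn.comp_isSemialgebraicMapOn_holds r₁.isSemialgebraicFunOn_integrand hι
      (fun z hz => hslice z hz)
  -- `P` read off `r₄`
  set P : (Fin (n + 1) → ℝ) → ℝ := fun z => r₄.integrand z * V z with hP
  have hPeq : ∀ x ∈ τ, ∀ t ∈ Ioo (a x) (b x),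
      P (Fin.snoc x t) = H (Fin.snoc x t) * V' (Fin.snoc x t) := by
    intro x hx t ht
    have hz := hmemB x hx t (Ioo_subset_Icc_self ht)
    have h := hr₄i _ hz (by simpa using ht.1) (by simpa using ht.2)
    simp only [hP, h]
    exact div_mul_cancel₀ _ (hV0 _ hz)
  have hRBi : EqOn r₄.integrand (fun z => P z / V z) r₄.domain := fun z hz => by
    simp only [hP]
    exact (mul_div_cancel_right₀ _ (hV0 z hz)).symm
  -- fibre derivatives with `H''`
  have hder' : ∀ x ∈ τ, ∀ t ∈ Ioo (a x) (b x),
      HasDerivAt (fun s : ℝ => H (Fin.snoc x s)) (H'' (Fin.snoc x t)) t ∧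
      HasDerivAt (fun s : ℝ => V (Fin.snoc x s)) (V' (Fin.snoc x t)) t := by
    intro x hx t ht
    rw [hH''eq _ (hmemB x hx t (Ioo_subset_Icc_self ht)) (by simpa using ht.1) (by simpa using ht.2)]
    exact hder x hx t ht
  -- domains and integrands of the four representations, in the engine's shape
  have hWd : r₁.domain = KZlog.band (KZlog.band τ a b) (fun _ => 1) V := by
    rw [hr₁d, hBeq]
    rfl
  have hWi : ∀ w ∈ r₁.domain, a (Fin.init (Fin.init w)) < Fin.init w (Fin.last n) →
      Fin.init w (Fin.last n) < b (Fin.init (Fin.init w)) →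
      r₁.integrand w = H'' (Fin.init w) / w (Fin.last (n + 1)) := by
    intro w hw h1 h2
    have hw' : Fin.init w ∈ r₄.domain := by
      rw [hr₁d] at hw
      exact hw.1
    rw [hr₁i w hw h1 h2, hH''eq _ hw' h1 h2]
  have hUbd : r₂.domain = KZlog.band τ (fun _ => 1) (fun x => V (Fin.snoc x (b x))) := by
    rw [hr₂d]
    rfl
  have hUbi : EqOn r₂.integrand
      (fun z => H (Fin.snoc (Fin.init z) (b (Fin.init z))) / z (Fin.last n)) r₂.domain :=
    fun z hz => hr₂i z hz
  have hUad : r₃.neg.domain = KZlog.band τ (fun _ => 1) (fun x => V (Fin.snoc x (a x))) := by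
    rw [KZ.IntegralRep.domain_neg, hr₃d]
    rfl
  have hUai : EqOn r₃.neg.integrand
      (fun z => -H (Fin.snoc (Fin.init z) (a (Fin.init z))) / z (Fin.last n)) r₃.neg.domain := by
    intro z hz
    rw [KZ.IntegralRep.domain_neg] at hz
    simp only [KZ.IntegralRep.integrand_neg, Pi.neg_apply, hr₃i z hz, neg_div]
  -- the engine, then the sign of `r₃`
  have hH₁ : IsSemialgebraicFunOn ℚ (KZlog.band τ a b) H := hBeq ▸ hH
  have hH₂ : IsSemialgebraicFunOn ℚ (KZlog.band τ a b) H'' := hBeq ▸ hH''sa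
  have hV₂ : IsSemialgebraicFunOn ℚ (KZlog.band τ a b) V := hBeq ▸ hV
  have hV1' : ∀ z ∈ KZlog.band τ a b, 1 ≤ V z := fun z hz => hV1 z (by rw [hBeq]; exact hz)
  have key := engineOfReps n τ a b H H'' V V' P r₄ r₁ r₂ r₃.neg hτ ha hb hab hH₁ hH₂ hV₂ hV1' hcont
    hder' hPeq hBeq hRBi hWd hWi hUbd hUbi hUad hUai
  have hneg : KZ.of r₃ + KZ.of r₃.neg ∈ KZ.relations :=
    KZ.levelRel_le_relations (KZ.of_add_of_neg_mem_levelRel r₃)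
  have hsum : KZ.of r₁ - KZ.of r₂ + KZ.of r₃ + KZ.of r₄ =
      (KZ.of r₄ + KZ.of r₁ - KZ.of r₂ - KZ.of r₃.neg) + (KZ.of r₃ + KZ.of r₃.neg) := by abel
  rw [hsum]
  exact KZ.relations.add_mem key hneg

end Summit.KontsevichZagierPeriods.LiouvilleUnfolding.Engine
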